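import Literature.NumberTheory.Automorphic.UnitaryGroupHeisenbergRingHaar          -- ★ `HeisRing.heisHomeomorph` (chart `R × R⁻ ≃ₜ N`), `heisElt ∕ heisMatrix ∕ heisMatrixInv ∕ heisZ`
import Literature.NumberTheory.Automorphic.HeisenbergResidualRankStrata           -- ★ L-α2a (this seat, p846226): `rank_redMat_heisMatrix_sub_one_eq_two ∕ _one ∕ _zero`, `valuation_heisZ_le_one`
import Literature.NumberTheory.Automorphic.CMPrincipalSeriesSpherical             -- ★ `mem_cmLocalIntegralLevel_iff_forall_v_le_one`; closure: ★ `ValuedFieldValuativeRelBridge`, ★ `AdicCompletionLocalField`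
import Literature.NumberTheory.Automorphic.AnisotropicUnitaryGroupCompactOfPlace  -- ★ `conjLocal_apply_eq_of_smul_eq` (`(c ⊗ 1) y` read at `w` is `σ_w y_w`)
import HarnessLib

/-!
# The Heisenberg chart of `N ≤ U(Φ₃)(L⁺_v)` at a non-split place: integral points and the residual rank strata in coordinates

Topic `NumberTheory/Automorphic`; namespace `Literature.NumberTheory.Automorphic.UnitaryGroup`.  KERNEL MATHEMATICS ONLY: theorems, no
definition, no named fact, no `sorry`, no instance, no notation.  Cell `pub/hodgecm-mathlib`, road «S3-tree», T3′ «DEPTH-ZERO κ-TRANSFER» (HEAD v4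
clause `depthZeroKappaTransfer_hyperspecial_levi`, population P-3 «LEVI»), organ **L-α2b FILE A** (seat F0P3a-p04 (g16)).  HONEST LABEL: HC_CM is proved
only modulo the 2 remaining named inputs (hLiu418 24832, h413 24833) until rung 0 closes; this file discharges nothing.

THE MATHEMATICS ([Rogawski1990] §1.10 p. 9, §4.9 p. 54; [Flicker1998UnitaryFL] §2).  `L` CM, `v` a finite place of `L⁺` that is NON-SPLIT in `L`
(`w ∣ v`, `c • w = w`; `w` is then the only place above `v`, ★ `PlacesOver.subsingleton_of_smul_eq`), `v ∤ 2` (`|2|_w = 1`), `R = L ⊗ L⁺_v = ∏_{w′∣v} L_{w′}`,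
`σ = c ⊗ 1`, `N = unipotentU σ Φ₃` the unipotent radical of the Borel subgroup of `U(Φ₃)(L⁺_v)`, in the Heisenberg chart ★ `HeisRing.heisElt x y = u(x, z)`,
`z = y − ½ x σx`, `y ∈ R⁻` skew (★ `UnitaryGroupHeisenbergRing`), and `K₃ = U(Φ₃)(𝒪_v)` the hyperspecial level (★ `cmLocalIntegralLevel`).
* §0 `|σ x|_w = |x|_w` on `R` (★ `conjLocal_apply_eq_of_smul_eq` + ★ `valued_galAdicCompletionMap`); `2` is a unit of `R`.
* §1 **`u(x, z) ∈ K₃ ⟺ |x_w| ≤ 1 ∧ |y_w| ≤ 1`** (`heisElt_mem_cmLocalIntegralLevel_iff`; ★ `mem_cmLocalIntegralLevel_iff_forall_v_le_one`: all entries of `u` AND of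
  `u⁻¹ = heisMatrixInv` integral; `|z|_w ≤ 1 ⟺ |y|_w ≤ 1` for integral `x`, ★ `valuation_heisZ_le_one`).
* §2 **the residual Jordan rank of `u(x,z)_w − 1`** — the `w`-component of the matrix of `u(x, z)` IS ★ `heisMatrix σ_w x_w y_w` (`σ_w` the conjugation of
  `L_w`, ★ `galAdicCompletionMap c hw`), so ★ L-α2a gives `rank(red(u_w) − 1) = 2` iff `|x_w| = 1`, `= 1` iff `|x_w| < 1 = |y_w|`, `= 0` iff `|x_w|, |y_w| < 1`
  (`rank_redMat_map_heisElt_sub_one_eq_two ∕ _one ∕ _zero`), and `(red(u_w) − 1)³ = 0` (`redMat_map_heisElt_sub_one_pow_three`).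
* §3 **the three rank strata of `N ∩ K₃` in the chart are PRODUCTS**: `heisHomeomorph⁻¹ {n ∈ K₃} = 𝒪 × 𝒪⁻`, `… ∧ rank = 2} = 𝒪^× × 𝒪⁻`,
  `… ∧ rank = 1} = 𝔪 × (𝒪⁻ ∖ 𝔪⁻)`, `… ∧ rank = 0} = 𝔪 × 𝔪⁻` (`preimage_heisHomeomorph_setOf_mem`, `preimage_heisHomeomorph_rankStratum_two ∕ _one ∕ _zero`)
  — FILE B (`HeisenbergStrataMeasure`) turns these into the volumes `(1 − q⁻², q⁻²(1 − q⁻¹), q⁻³)·μ_N(N ∩ K₃)`, `q = N𝔭_v`, for EVERY Haar measure of `N`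
  (★ `heisHaar`, ★ L-β0 `NonsplitPlaceHaarBallRatios`), the finite-Heisenberg-group count `(q³ − q, q − 1, 1)∕q³` of [Rogawski1990] §4.9 p. 54.

## References
* [Rogawski1990] J. D. Rogawski, *Automorphic Representations of Unitary Groups in Three Variables*, Ann. of Math. Stud. 123 (1990), §1.10 p. 9; §4.9 p. 54.
* [Flicker1998UnitaryFL] Y. Z. Flicker, *Elementary proof of the fundamental lemma for a unitary group*, Canad. J. Math. 50 (1998), §2.
* [PlatonovRapinchuk1994] V. Platonov, A. Rapinchuk, *Algebraic Groups and Number Theory* (1994), §5.1 (integral points at a place).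
-/

set_option autoImplicit false

noncomputable section

open IsDedekindDomain NumberField Matrix ValuativeRel
open scoped NumberField MatrixGroups Matrix

namespace Literature.NumberTheory.Automorphic.UnitaryGroup

open Literature.NumberTheory.Automorphic Literature.NumberTheory.Automorphic.IntegralReduction

variable (L : Type) [Field L] [NumberField L] [IsCMField L] (v : HeightOneSpectrum (𝓞 ↥(maximalRealSubfield L)))
  (w : PlacesOver L v) (hw : IsCMField.complexConj L • w.1 = w.1)

/-! ## §0 Bookkeeping on `R = ∏_{w′ ∣ v} L_{w′}` at a non-split place -/

omit [IsCMField L] in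
/-- `2` is a unit of `R = L ⊗ L⁺_v` (each factor `L_{w′}` has characteristic `0`). [cite: Rogawski1990, §1.10 p. 9] -/
theorem isUnit_two_localRing : IsUnit (2 : LocalRing L v) :=
  isUnit_iff_exists_inv.2 ⟨fun w' => (2 : w'.1.adicCompletion L)⁻¹, funext fun _ => mul_inv_cancel₀ two_ne_zero⟩

include hw in
/-- **`|σ x|_w = |x|_w`** at a non-split place: `(σ x)_w = σ_w (x_w)` (★ `conjLocal_apply_eq_of_smul_eq`) and `σ_w` is an isometry (★ `valued_galAdicCompletionMap`).
[cite: Rogawski1990, §1.9 p. 8] [cite: PlatonovRapinchuk1994, §5.1] -/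
theorem valued_conjLocal_apply_of_smul_eq (x : LocalRing L v) : Valued.v (conjLocal L (IsCMField.complexConj L) v x w) = Valued.v (x w) := by
  haveI : Algebra.IsQuadraticExtension ↥(maximalRealSubfield L) L := IsCMField.isQuadraticExtension L
  rw [conjLocal_apply_eq_of_smul_eq (IsCMField.complexConj L) (IsCMField.complexConj_ne_one L) v w hw x, valued_galAdicCompletionMap]

omit [IsCMField L] in
/-- `|(⅟2)_w| = 1` when `|2|_w = 1`. [cite: Rogawski1990, §1.10 p. 9] -/
theorem valued_invOf_two_apply [Invertible (2 : LocalRing L v)] (h2w : Valued.v (2 : w.1.adicCompletion L) = 1) :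
    Valued.v ((⅟ (2 : LocalRing L v)) w) = 1 := by
  have h := congrFun (invOf_mul_self (2 : LocalRing L v)) w
  rw [Pi.mul_apply, Pi.one_apply, Pi.ofNat_apply] at h
  have hv := congrArg Valued.v h
  rw [map_mul, h2w, mul_one, map_one] at hv
  exact hv

/-- The `w`-component of `σ = c ⊗ 1` as a ring endomorphism `σ_w` of `L_w`, evaluated: `(σ x)_w = σ_w x_w` (★ `conjLocal_apply_eq_of_smul_eq`, CM spelling).
[cite: PlatonovRapinchuk1994, §5.1] -/
private theorem conjLocal_apply_w (x : LocalRing L v) :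
    conjLocal L (IsCMField.complexConj L) v x w = galAdicCompletionMap (L := L) (IsCMField.complexConj L) hw (x w) := by
  haveI : Algebra.IsQuadraticExtension ↥(maximalRealSubfield L) L := IsCMField.isQuadraticExtension L
  exact conjLocal_apply_eq_of_smul_eq (IsCMField.complexConj L) (IsCMField.complexConj_ne_one L) v w hw x

/-- `σ_w` is an isometry in the `ValuativeRel` currency of ★ L-α2a. [cite: Rogawski1990, §1.9 p. 8] -/
private theorem valuation_galAdicCompletionMap (z : w.1.adicCompletion L) :
    valuation (w.1.adicCompletion L) (galAdicCompletionMap (L := L) (IsCMField.complexConj L) hw z) = valuation (w.1.adicCompletion L) z :=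
  (v_eq_iff_valuation_eq _ _).1 (valued_galAdicCompletionMap L (IsCMField.complexConj L) hw z)

/-! ## §1 The matrix of `u(x, z)` at `w` and membership in `K₃` -/

/-- **The `w`-component of the matrix of `u(x, z)` is the Heisenberg matrix of `L_w`**: `u(x,z)_w = heisMatrix σ_w x_w y_w` (for the instance `⅟2` of `L_w` read off from
that of `R`). [cite: Rogawski1990, §1.10 p. 9] -/
private theorem map_mat_heisElt_eq_heisMatrix [Invertible (2 : LocalRing L v)] [Invertible (2 : w.1.adicCompletion L)]
    (hi : (⅟ (2 : LocalRing L v)) w = ⅟ (2 : w.1.adicCompletion L)) (x : LocalRing L v) (y : HeisRing.skewPart (conjLocal L (IsCMField.complexConj L) v)) :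
    ((HeisRing.heisElt (conjLocal L (IsCMField.complexConj L) v) (conjLocal_conjLocal_cm L v) (cmLocalForm_eq_over L 3 v) x y :
        ↥(unitaryGroupOfForm (conjLocal L (IsCMField.complexConj L) v) (cmLocalForm L 3 v))) : GL (Fin 3) (LocalRing L v)).val.map
        (Pi.evalRingHom (fun w' : PlacesOver L v => w'.1.adicCompletion L) w) =
      HeisRing.heisMatrix (galAdicCompletionMap (L := L) (IsCMField.complexConj L) hw) (x w) ((y : LocalRing L v) w) := by
  have hM : ((HeisRing.heisElt (conjLocal L (IsCMField.complexConj L) v) (conjLocal_conjLocal_cm L v) (cmLocalForm_eq_over L 3 v) x y :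
        ↥(unitaryGroupOfForm (conjLocal L (IsCMField.complexConj L) v) (cmLocalForm L 3 v))) : GL (Fin 3) (LocalRing L v)).val =
      HeisRing.heisMatrix (conjLocal L (IsCMField.complexConj L) v) x y := rfl
  have hz : (HeisRing.heisZ (conjLocal L (IsCMField.complexConj L) v) x (y : LocalRing L v)) w =
      HeisRing.heisZ (galAdicCompletionMap (L := L) (IsCMField.complexConj L) hw) (x w) ((y : LocalRing L v) w) := by
    simp only [HeisRing.heisZ, Pi.sub_apply, Pi.mul_apply, hi, conjLocal_apply_w L v w hw]
  rw [hM]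
  ext i j
  fin_cases i <;> fin_cases j <;>
    simp [HeisRing.heisMatrix, Matrix.map_apply, hz, conjLocal_apply_w L v w hw]

include hw in
/-- **RANK 2 STRATUM**: `|x_w| = 1` ⇒ `rank(red(u(x,z)_w) − 1) = 2` (★ L-α2a `rank_redMat_heisMatrix_sub_one_eq_two` at `σ_w`). [cite: Rogawski1990, §4.9 p. 54]
[cite: Flicker1998UnitaryFL, §2] -/
theorem rank_redMat_map_heisElt_sub_one_eq_two [Invertible (2 : LocalRing L v)] {x : LocalRing L v} (hx : Valued.v (x w) = 1)
    (y : HeisRing.skewPart (conjLocal L (IsCMField.complexConj L) v)) :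
    (redMat (((HeisRing.heisElt (conjLocal L (IsCMField.complexConj L) v) (conjLocal_conjLocal_cm L v) (cmLocalForm_eq_over L 3 v) x y :
        ↥(unitaryGroupOfForm (conjLocal L (IsCMField.complexConj L) v) (cmLocalForm L 3 v))) : GL (Fin 3) (LocalRing L v)).val.map
        (Pi.evalRingHom (fun w' : PlacesOver L v => w'.1.adicCompletion L) w)) - 1).rank = 2 := by
  letI : Invertible (2 : w.1.adicCompletion L) :=
    ⟨(⅟ (2 : LocalRing L v)) w, by simpa [Pi.mul_apply, Pi.ofNat_apply] using congrFun (invOf_mul_self (2 : LocalRing L v)) w,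
      by simpa [Pi.mul_apply, Pi.ofNat_apply] using congrFun (mul_invOf_self (2 : LocalRing L v)) w⟩
  rw [map_mat_heisElt_eq_heisMatrix L v w hw rfl x y]
  exact HeisRing.rank_redMat_heisMatrix_sub_one_eq_two _ (valuation_galAdicCompletionMap L v w hw) ((v_eq_one_iff_valuation_eq_one _).1 hx) _

include hw in
/-- **RANK 1 STRATUM**: `|x_w| < 1`, `|y_w| = 1` (and `|2|_w = 1`) ⇒ `rank(red(u(x,z)_w) − 1) = 1`. [cite: Rogawski1990, §4.9 p. 54] [cite: Flicker1998UnitaryFL, §2] -/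
theorem rank_redMat_map_heisElt_sub_one_eq_one [Invertible (2 : LocalRing L v)] (h2w : Valued.v (2 : w.1.adicCompletion L) = 1)
    {x : LocalRing L v} {y : HeisRing.skewPart (conjLocal L (IsCMField.complexConj L) v)} (hx : Valued.v (x w) < 1) (hy : Valued.v ((y : LocalRing L v) w) = 1) :
    (redMat (((HeisRing.heisElt (conjLocal L (IsCMField.complexConj L) v) (conjLocal_conjLocal_cm L v) (cmLocalForm_eq_over L 3 v) x y :
        ↥(unitaryGroupOfForm (conjLocal L (IsCMField.complexConj L) v) (cmLocalForm L 3 v))) : GL (Fin 3) (LocalRing L v)).val.map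
        (Pi.evalRingHom (fun w' : PlacesOver L v => w'.1.adicCompletion L) w)) - 1).rank = 1 := by
  letI : Invertible (2 : w.1.adicCompletion L) :=
    ⟨(⅟ (2 : LocalRing L v)) w, by simpa [Pi.mul_apply, Pi.ofNat_apply] using congrFun (invOf_mul_self (2 : LocalRing L v)) w,
      by simpa [Pi.mul_apply, Pi.ofNat_apply] using congrFun (mul_invOf_self (2 : LocalRing L v)) w⟩
  rw [map_mat_heisElt_eq_heisMatrix L v w hw rfl x y]
  exact HeisRing.rank_redMat_heisMatrix_sub_one_eq_one _ (valuation_galAdicCompletionMap L v w hw) ((v_eq_one_iff_valuation_eq_one _).1 h2w)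
    ((v_lt_one_iff_valuation_lt_one _).1 hx) ((v_eq_one_iff_valuation_eq_one _).1 hy)

include hw in
/-- **RANK 0 STRATUM**: `|x_w| < 1`, `|y_w| < 1` (and `|2|_w = 1`) ⇒ `rank(red(u(x,z)_w) − 1) = 0`. [cite: Rogawski1990, §4.9 p. 54] [cite: Flicker1998UnitaryFL, §2] -/
theorem rank_redMat_map_heisElt_sub_one_eq_zero [Invertible (2 : LocalRing L v)] (h2w : Valued.v (2 : w.1.adicCompletion L) = 1)
    {x : LocalRing L v} {y : HeisRing.skewPart (conjLocal L (IsCMField.complexConj L) v)} (hx : Valued.v (x w) < 1) (hy : Valued.v ((y : LocalRing L v) w) < 1) :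
    (redMat (((HeisRing.heisElt (conjLocal L (IsCMField.complexConj L) v) (conjLocal_conjLocal_cm L v) (cmLocalForm_eq_over L 3 v) x y :
        ↥(unitaryGroupOfForm (conjLocal L (IsCMField.complexConj L) v) (cmLocalForm L 3 v))) : GL (Fin 3) (LocalRing L v)).val.map
        (Pi.evalRingHom (fun w' : PlacesOver L v => w'.1.adicCompletion L) w)) - 1).rank = 0 := by
  letI : Invertible (2 : w.1.adicCompletion L) :=
    ⟨(⅟ (2 : LocalRing L v)) w, by simpa [Pi.mul_apply, Pi.ofNat_apply] using congrFun (invOf_mul_self (2 : LocalRing L v)) w,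
      by simpa [Pi.mul_apply, Pi.ofNat_apply] using congrFun (mul_invOf_self (2 : LocalRing L v)) w⟩
  rw [map_mat_heisElt_eq_heisMatrix L v w hw rfl x y]
  exact HeisRing.rank_redMat_heisMatrix_sub_one_eq_zero _ (valuation_galAdicCompletionMap L v w hw) ((v_eq_one_iff_valuation_eq_one _).1 h2w)
    ((v_lt_one_iff_valuation_lt_one _).1 hx) ((v_lt_one_iff_valuation_lt_one _).1 hy)

include hw in
/-- **`(red(u(x,z)_w) − 1)³ = 0`** for integral coordinates: `red(u_w) − 1` is strictly upper triangular (★ L-α1 `redMat_unitriangular_sub_one`, `strictUpper_pow_three`) — the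
residually-unipotent guard of HEAD v4's depth-zero pieces holds on `N ∩ K₃`. [cite: Rogawski1990, §4.9 p. 54] -/
theorem redMat_map_heisElt_sub_one_pow_three [Invertible (2 : LocalRing L v)] (x : LocalRing L v) (y : HeisRing.skewPart (conjLocal L (IsCMField.complexConj L) v)) :
    (redMat (((HeisRing.heisElt (conjLocal L (IsCMField.complexConj L) v) (conjLocal_conjLocal_cm L v) (cmLocalForm_eq_over L 3 v) x y :
        ↥(unitaryGroupOfForm (conjLocal L (IsCMField.complexConj L) v) (cmLocalForm L 3 v))) : GL (Fin 3) (LocalRing L v)).val.map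
        (Pi.evalRingHom (fun w' : PlacesOver L v => w'.1.adicCompletion L) w)) - 1) ^ 3 = 0 := by
  letI : Invertible (2 : w.1.adicCompletion L) :=
    ⟨(⅟ (2 : LocalRing L v)) w, by simpa [Pi.mul_apply, Pi.ofNat_apply] using congrFun (invOf_mul_self (2 : LocalRing L v)) w,
      by simpa [Pi.mul_apply, Pi.ofNat_apply] using congrFun (mul_invOf_self (2 : LocalRing L v)) w⟩
  rw [map_mat_heisElt_eq_heisMatrix L v w hw rfl x y]
  unfold HeisRing.heisMatrix
  rw [redMat_unitriangular_sub_one]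
  exact strictUpper_pow_three _ _ _

include hw in
/-- **INTEGRAL POINTS OF `N` IN THE CHART: `u(x, z) ∈ K₃ = U(Φ₃)(𝒪_v) ⟺ |x_w| ≤ 1 ∧ |y_w| ≤ 1`** (`v ∤ 2`).  `K₃`-membership is integrality of all entries of
`u = heisMatrix σ x y` and of `u⁻¹ = heisMatrixInv σ x y` at the unique place `w` (★ `mem_cmLocalIntegralLevel_iff_forall_v_le_one`); those entries are
`1, 0, ±x, ±σx, z, σz` with `|σ·|_w = |·|_w`, and `|z|_w ≤ 1 ⟺ |y|_w ≤ 1` for integral `x` (★ L-α2a `valuation_heisZ_le_one`).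
[cite: Rogawski1990, §1.10 p. 9; §4.9 p. 54] [cite: PlatonovRapinchuk1994, §5.1] -/
theorem heisElt_mem_cmLocalIntegralLevel_iff [Invertible (2 : LocalRing L v)] (h2w : Valued.v (2 : w.1.adicCompletion L) = 1)
    (x : LocalRing L v) (y : HeisRing.skewPart (conjLocal L (IsCMField.complexConj L) v)) :
    (HeisRing.heisElt (conjLocal L (IsCMField.complexConj L) v) (conjLocal_conjLocal_cm L v) (cmLocalForm_eq_over L 3 v) x y :
        ↥(unitaryGroupOfForm (conjLocal L (IsCMField.complexConj L) v) (cmLocalForm L 3 v))) ∈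
        cmLocalIntegralLevel L 3 (Matrix.of fun i j : Fin 3 => if i.val + j.val + 1 = 3 then (1 : L) else 0) v ↔
      Valued.v (x w) ≤ 1 ∧ Valued.v ((y : LocalRing L v) w) ≤ 1 := by
  haveI : Algebra.IsQuadraticExtension ↥(maximalRealSubfield L) L := IsCMField.isQuadraticExtension L
  haveI : Subsingleton (PlacesOver L v) :=
    PlacesOver.subsingleton_of_smul_eq (IsCMField.complexConj L) (IsCMField.complexConj_ne_one L) w hw
  letI : Invertible (2 : w.1.adicCompletion L) :=
    ⟨(⅟ (2 : LocalRing L v)) w, by simpa [Pi.mul_apply, Pi.ofNat_apply] using congrFun (invOf_mul_self (2 : LocalRing L v)) w,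
      by simpa [Pi.mul_apply, Pi.ofNat_apply] using congrFun (mul_invOf_self (2 : LocalRing L v)) w⟩
  -- `|z_w| ≤ 1 ⟺ |y_w| ≤ 1` for integral `x` (★ L-α2a at `σ_w`)
  have hzy : Valued.v (x w) ≤ 1 → (Valued.v ((HeisRing.heisZ (conjLocal L (IsCMField.complexConj L) v) x (y : LocalRing L v)) w) ≤ 1 ↔
      Valued.v ((y : LocalRing L v) w) ≤ 1) := fun hx => by
    have hz : (HeisRing.heisZ (conjLocal L (IsCMField.complexConj L) v) x (y : LocalRing L v)) w =
        HeisRing.heisZ (galAdicCompletionMap (L := L) (IsCMField.complexConj L) hw) (x w) ((y : LocalRing L v) w) := by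
      simp only [HeisRing.heisZ, Pi.sub_apply, Pi.mul_apply, conjLocal_apply_w L v w hw]
      rfl
    rw [hz, v_le_one_iff_valuation_le_one, v_le_one_iff_valuation_le_one]
    exact HeisRing.valuation_heisZ_le_one _ (valuation_galAdicCompletionMap L v w hw) ((v_eq_one_iff_valuation_eq_one _).1 h2w)
      ((v_le_one_iff_valuation_le_one _).1 hx) _
  have hσv : ∀ r : LocalRing L v, Valued.v (conjLocal L (IsCMField.complexConj L) v r w) = Valued.v (r w) := valued_conjLocal_apply_of_smul_eq L v w hw
  rw [mem_cmLocalIntegralLevel_iff_forall_v_le_one]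
  change ((∀ (i j : Fin 3) (w' : PlacesOver L v), Valued.v (HeisRing.heisMatrix (conjLocal L (IsCMField.complexConj L) v) x (y : LocalRing L v) i j w') ≤ 1) ∧
      ∀ (i j : Fin 3) (w' : PlacesOver L v), Valued.v (HeisRing.heisMatrixInv (conjLocal L (IsCMField.complexConj L) v) x (y : LocalRing L v) i j w') ≤ 1) ↔ _
  constructor
  · rintro ⟨h, -⟩
    have h01 := h 0 1 w
    have h02 := h 0 2 w
    simp only [HeisRing.heisMatrix, Matrix.of_apply, Matrix.cons_val', Matrix.cons_val_zero, Matrix.cons_val_one, Matrix.cons_val_two,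
      Matrix.empty_val', Matrix.cons_val_fin_one, Matrix.head_cons, Matrix.tail_cons] at h01 h02
    exact ⟨h01, (hzy h01).1 h02⟩
  · rintro ⟨hx, hy⟩
    have hz := (hzy hx).2 hy
    have hσx : Valued.v ((conjLocal L (IsCMField.complexConj L) v x) w) ≤ 1 := by rw [hσv]; exact hx
    have hσz : Valued.v ((conjLocal L (IsCMField.complexConj L) v (HeisRing.heisZ (conjLocal L (IsCMField.complexConj L) v) x (y : LocalRing L v))) w) ≤ 1 := by
      rw [hσv]; exact hz
    refine ⟨fun i j w' => ?_, fun i j w' => ?_⟩ <;> obtain rfl : w' = w := Subsingleton.elim _ _ <;>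
      fin_cases i <;> fin_cases j <;>
        simp [-conjLocal_apply, HeisRing.heisMatrix, HeisRing.heisMatrixInv, hx, hz, hσx, hσz]

/-! ## §3 The strata of `N ∩ K₃` are products in the chart -/

include hw in
/-- **`heisHomeomorph⁻¹ {n ∈ K₃} = 𝒪 × 𝒪⁻`** (`𝒪 = {|x_w| ≤ 1}`, `𝒪⁻ = {y ∈ R⁻ : |y_w| ≤ 1}`). [cite: Rogawski1990, §1.10 p. 9; §4.9 p. 54] -/
theorem preimage_heisHomeomorph_setOf_mem [Invertible (2 : LocalRing L v)] (h2w : Valued.v (2 : w.1.adicCompletion L) = 1) :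
    (HeisRing.heisHomeomorph (conjLocal L (IsCMField.complexConj L) v) (conjLocal_conjLocal_cm L v) (continuous_conjLocal L (IsCMField.complexConj L) v)
        (cmLocalForm_eq_over L 3 v)) ⁻¹'
        {n | (n : ↥(unitaryGroupOfForm (conjLocal L (IsCMField.complexConj L) v) (cmLocalForm L 3 v))) ∈
          cmLocalIntegralLevel L 3 (Matrix.of fun i j : Fin 3 => if i.val + j.val + 1 = 3 then (1 : L) else 0) v} =
      {x : LocalRing L v | Valued.v (x w) ≤ 1} ×ˢ {y : HeisRing.skewPart (conjLocal L (IsCMField.complexConj L) v) | Valued.v ((y : LocalRing L v) w) ≤ 1} := by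
  ext ⟨x, y⟩
  simp only [Set.mem_preimage, Set.mem_setOf_eq, HeisRing.heisHomeomorph_apply, Set.mem_prod]
  exact heisElt_mem_cmLocalIntegralLevel_iff L v w hw h2w x y

include hw in
/-- **RANK 2 STRATUM = `𝒪^× × 𝒪⁻`**: `heisHomeomorph⁻¹ {n ∈ K₃ : rank(red(n_w) − 1) = 2} = {|x_w| = 1} × {|y_w| ≤ 1}`. [cite: Rogawski1990, §4.9 p. 54] [cite: Flicker1998UnitaryFL, §2] -/
theorem preimage_heisHomeomorph_rankStratum_two [Invertible (2 : LocalRing L v)] (h2w : Valued.v (2 : w.1.adicCompletion L) = 1) :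
    (HeisRing.heisHomeomorph (conjLocal L (IsCMField.complexConj L) v) (conjLocal_conjLocal_cm L v) (continuous_conjLocal L (IsCMField.complexConj L) v)
        (cmLocalForm_eq_over L 3 v)) ⁻¹'
        {n | (n : ↥(unitaryGroupOfForm (conjLocal L (IsCMField.complexConj L) v) (cmLocalForm L 3 v))) ∈
            cmLocalIntegralLevel L 3 (Matrix.of fun i j : Fin 3 => if i.val + j.val + 1 = 3 then (1 : L) else 0) v ∧
          (redMat (((n : ↥(unitaryGroupOfForm (conjLocal L (IsCMField.complexConj L) v) (cmLocalForm L 3 v))) : GL (Fin 3) (LocalRing L v)).val.map (Pi.evalRingHom (fun w' : PlacesOver L v => w'.1.adicCompletion L) w)) - 1).rank = 2} =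
      {x : LocalRing L v | Valued.v (x w) = 1} ×ˢ {y : HeisRing.skewPart (conjLocal L (IsCMField.complexConj L) v) | Valued.v ((y : LocalRing L v) w) ≤ 1} := by
  ext ⟨x, y⟩
  simp only [Set.mem_preimage, Set.mem_setOf_eq, HeisRing.heisHomeomorph_apply, Set.mem_prod]
  constructor
  · rintro ⟨hmem, hr⟩
    obtain ⟨hx, hy⟩ := (heisElt_mem_cmLocalIntegralLevel_iff L v w hw h2w x y).1 hmem
    refine ⟨?_, hy⟩
    by_contra hne
    have hx' : Valued.v (x w) < 1 := lt_of_le_of_ne hx hne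
    rcases hy.lt_or_eq with hy' | hy'
    · rw [rank_redMat_map_heisElt_sub_one_eq_zero L v w hw h2w hx' hy'] at hr; exact absurd hr (by decide)
    · rw [rank_redMat_map_heisElt_sub_one_eq_one L v w hw h2w hx' hy'] at hr; exact absurd hr (by decide)
  · rintro ⟨hx, hy⟩
    exact ⟨(heisElt_mem_cmLocalIntegralLevel_iff L v w hw h2w x y).2 ⟨hx.le, hy⟩, rank_redMat_map_heisElt_sub_one_eq_two L v w hw hx y⟩

include hw in
/-- **RANK 1 STRATUM = `𝔪 × (𝒪⁻ ∖ 𝔪⁻)`**: `heisHomeomorph⁻¹ {n ∈ K₃ : rank(red(n_w) − 1) = 1} = {|x_w| < 1} × {|y_w| = 1}`. [cite: Rogawski1990, §4.9 p. 54] [cite: Flicker1998UnitaryFL, §2] -/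
theorem preimage_heisHomeomorph_rankStratum_one [Invertible (2 : LocalRing L v)] (h2w : Valued.v (2 : w.1.adicCompletion L) = 1) :
    (HeisRing.heisHomeomorph (conjLocal L (IsCMField.complexConj L) v) (conjLocal_conjLocal_cm L v) (continuous_conjLocal L (IsCMField.complexConj L) v)
        (cmLocalForm_eq_over L 3 v)) ⁻¹'
        {n | (n : ↥(unitaryGroupOfForm (conjLocal L (IsCMField.complexConj L) v) (cmLocalForm L 3 v))) ∈
            cmLocalIntegralLevel L 3 (Matrix.of fun i j : Fin 3 => if i.val + j.val + 1 = 3 then (1 : L) else 0) v ∧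
          (redMat (((n : ↥(unitaryGroupOfForm (conjLocal L (IsCMField.complexConj L) v) (cmLocalForm L 3 v))) : GL (Fin 3) (LocalRing L v)).val.map (Pi.evalRingHom (fun w' : PlacesOver L v => w'.1.adicCompletion L) w)) - 1).rank = 1} =
      {x : LocalRing L v | Valued.v (x w) < 1} ×ˢ {y : HeisRing.skewPart (conjLocal L (IsCMField.complexConj L) v) | Valued.v ((y : LocalRing L v) w) = 1} := by
  ext ⟨x, y⟩
  simp only [Set.mem_preimage, Set.mem_setOf_eq, HeisRing.heisHomeomorph_apply, Set.mem_prod]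
  constructor
  · rintro ⟨hmem, hr⟩
    obtain ⟨hx, hy⟩ := (heisElt_mem_cmLocalIntegralLevel_iff L v w hw h2w x y).1 hmem
    rcases hx.lt_or_eq with hx' | hx'
    · refine ⟨hx', ?_⟩
      rcases hy.lt_or_eq with hy' | hy'
      · rw [rank_redMat_map_heisElt_sub_one_eq_zero L v w hw h2w hx' hy'] at hr; exact absurd hr (by decide)
      · exact hy'
    · rw [rank_redMat_map_heisElt_sub_one_eq_two L v w hw hx' y] at hr; exact absurd hr (by decide)
  · rintro ⟨hx, hy⟩
    exact ⟨(heisElt_mem_cmLocalIntegralLevel_iff L v w hw h2w x y).2 ⟨hx.le, hy.le⟩, rank_redMat_map_heisElt_sub_one_eq_one L v w hw h2w hx hy⟩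

include hw in
/-- **RANK 0 STRATUM = `𝔪 × 𝔪⁻`**: `heisHomeomorph⁻¹ {n ∈ K₃ : rank(red(n_w) − 1) = 0} = {|x_w| < 1} × {|y_w| < 1}`. [cite: Rogawski1990, §4.9 p. 54] [cite: Flicker1998UnitaryFL, §2] -/
theorem preimage_heisHomeomorph_rankStratum_zero [Invertible (2 : LocalRing L v)] (h2w : Valued.v (2 : w.1.adicCompletion L) = 1) :
    (HeisRing.heisHomeomorph (conjLocal L (IsCMField.complexConj L) v) (conjLocal_conjLocal_cm L v) (continuous_conjLocal L (IsCMField.complexConj L) v)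
        (cmLocalForm_eq_over L 3 v)) ⁻¹'
        {n | (n : ↥(unitaryGroupOfForm (conjLocal L (IsCMField.complexConj L) v) (cmLocalForm L 3 v))) ∈
            cmLocalIntegralLevel L 3 (Matrix.of fun i j : Fin 3 => if i.val + j.val + 1 = 3 then (1 : L) else 0) v ∧
          (redMat (((n : ↥(unitaryGroupOfForm (conjLocal L (IsCMField.complexConj L) v) (cmLocalForm L 3 v))) : GL (Fin 3) (LocalRing L v)).val.map (Pi.evalRingHom (fun w' : PlacesOver L v => w'.1.adicCompletion L) w)) - 1).rank = 0} =
      {x : LocalRing L v | Valued.v (x w) < 1} ×ˢ {y : HeisRing.skewPart (conjLocal L (IsCMField.complexConj L) v) | Valued.v ((y : LocalRing L v) w) < 1} := by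
  ext ⟨x, y⟩
  simp only [Set.mem_preimage, Set.mem_setOf_eq, HeisRing.heisHomeomorph_apply, Set.mem_prod]
  constructor
  · rintro ⟨hmem, hr⟩
    obtain ⟨hx, hy⟩ := (heisElt_mem_cmLocalIntegralLevel_iff L v w hw h2w x y).1 hmem
    rcases hx.lt_or_eq with hx' | hx'
    · refine ⟨hx', ?_⟩
      rcases hy.lt_or_eq with hy' | hy'
      · exact hy'
      · rw [rank_redMat_map_heisElt_sub_one_eq_one L v w hw h2w hx' hy'] at hr; exact absurd hr (by decide)
    · rw [rank_redMat_map_heisElt_sub_one_eq_two L v w hw hx' y] at hr; exact absurd hr (by decide)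
  · rintro ⟨hx, hy⟩
    exact ⟨(heisElt_mem_cmLocalIntegralLevel_iff L v w hw h2w x y).2 ⟨hx.le, hy.le⟩, rank_redMat_map_heisElt_sub_one_eq_zero L v w hw h2w hx hy⟩

end Literature.NumberTheory.Automorphic.UnitaryGroup

end
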